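import Literature.MathematicalPhysics.QuantumFieldTheory.ConformalBootstrap3D.PointKernelK34Data

/-!
# K34 certificate, kernel block file M0: (M) rows `0 ≤ j < 11` of `mrows`, in 7 row groups

`decide` by kernel reduction (no `native_decide`, no extra axioms) of the block checker of
`PointKernel` on the literal data of `PointKernelK34Data`; soundness is `PCert.mBlockOK_sound`.
Estimated kernel time 174 s (7 theorems).
-/

set_option maxRecDepth 100000
set_option maxHeartbeats 0

namespace Literature.MathematicalPhysics.QuantumFieldTheory.ConformalBootstrap3D.PointKernelK34

open Literature.MathematicalPhysics.QuantumFieldTheory.ConformalBootstrap3D.PointKernel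

/-- (M) rows `[0, 2)` pass the kernel evaluator. [folklore] -/
theorem mBlock_0 : cert.mBlockOK mrows 0 2 = true := by
  decide +kernel

/-- (M) rows `[2, 4)` pass the kernel evaluator. [folklore] -/
theorem mBlock_2 : cert.mBlockOK mrows 2 4 = true := by
  decide +kernel

/-- (M) rows `[4, 6)` pass the kernel evaluator. [folklore] -/
theorem mBlock_4 : cert.mBlockOK mrows 4 6 = true := by
  decide +kernel

/-- (M) rows `[6, 8)` pass the kernel evaluator. [folklore] -/
theorem mBlock_6 : cert.mBlockOK mrows 6 8 = true := by
  decide +kernel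

/-- (M) rows `[8, 9)` pass the kernel evaluator. [folklore] -/
theorem mBlock_8 : cert.mBlockOK mrows 8 9 = true := by
  decide +kernel

/-- (M) rows `[9, 10)` pass the kernel evaluator. [folklore] -/
theorem mBlock_9 : cert.mBlockOK mrows 9 10 = true := by
  decide +kernel

/-- (M) rows `[10, 11)` pass the kernel evaluator. [folklore] -/
theorem mBlock_10 : cert.mBlockOK mrows 10 11 = true := by
  decide +kernel

end Literature.MathematicalPhysics.QuantumFieldTheory.ConformalBootstrap3D.PointKernelK34
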